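import Summits.BirchSwinnertonDyer.BirchSwinnertonDyer.Theorems.TwinTransportX9RungSchemaTwoStep
import Literature.NumberTheory.QuadraticFields.FundamentalDiscriminant
import Literature.NumberTheory.EllipticCurves.QuadraticTwistHeegnerRootNumberProofs
import Literature.NumberTheory.EllipticCurves.RootNumberEvenAnalyticRankProofs
import Literature.NumberTheory.EllipticCurves.HeegnerFieldOfDiscriminantProofs
import Literature.NumberTheory.EllipticCurves.LFunctionSmulProofs
import Literature.NumberTheory.EllipticCurves.RootNumberSmulProofs

/-!
# Route `TwinTransportX9` — the PARITY LAW of the deciding crux `TrivialTwinSupplyX9` (item 24080), class-wide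

The crux body at `(W, p)` is a disjunction: ONE admissible step `W ↦ W₁ ≅ W^{(d_K)}` reaching a twin with
`r_an(W₁) = 0` (and the certificate), OR TWO admissible steps `W ↦ W₁ ↦ W₂ ≅ W₁^{(d_K')}` with `r_an(W₂) = 0`.
This file proves, for EVERY pair and EVERY admissible frame, from the Modularity Theorem (`exists_isNewformOf`,
BCDT 2001 Thm. A, a hypothesis as everywhere in the tree):

* `rootNumber_twin_eq_neg` — along every BCS-admissible frame the root number FLIPS: `w(W₁) = -w(W)` for every
  `W₁` with `C • W₁ = W^{(d_K)}`. Reason: (disc) makes `d_K < 0` a field discriminant, (Heeg) says every `ℓ ∣ N(W)`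
  splits in `K₀ = ℚ(√d_K)`, and then `w(W^{(d_K)}) = χ_{d_K}(-N) w(W) = -w(W)` (Darmon 2004 §3.6 / Gross 1984:
  `sign(E, K) = -1`; tree theorem `rootNumber_quadraticTwist_discr_eq_neg_of_exists_isNewformOf`), transported to
  `W₁` by isomorphism invariance of `w`.
* `even_analyticRank_twin_iff` — hence the analytic PARITY flips at each admissible step (`w = (-1)^{r_an}`), and
  returns after two steps (`even_analyticRank_twin₂_iff`).
* CONSEQUENCES FOR THE CRUX, class-wide: at a pair of EVEN analytic rank the FIRST disjunct is impossible for every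
  admissible frame (`analyticRank_twin_ne_zero_of_even`: `r_an(W₁)` is odd); at a pair of ODD analytic rank the
  SECOND disjunct is impossible for every pair of admissible frames (`analyticRank_twin₂_ne_zero_of_odd`), while
  every one-step twin has EVEN analytic rank (`even_analyticRank_twin_of_odd`: so `r_an(W₁) = 0` unless
  `r_an(W₁) ≥ 2`). So the crux SPLITS BY PARITY into two independent statements
  (`trivialTwinSupplyX9_parityCases`, `trivialTwinSupplyX9_of_parityCases`): odd pairs ⇒ one-step unit twin,
  even pairs ⇒ two-step unit twin — exactly the structure the decided instances exhibit (319 first-disjunct rungs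
  at rank-1 pairs; the rank-0 pairs needed the two-step engine, batches B01–B26).

HONEST FRAMING: BSD is NOT proved; `TrivialTwinSupplyX9` is NOT proved; everything here is conditional only on
the Modularity Theorem binder `hmod`. Helper theorems (`--supports` item 24080); 0 definitions, 0 named facts,
0 sorry. References: [Darmon2004] §3.6 Thm. 3.15/3.17, p. 39, §3.9 p. 40; [Gross1984] §3; [BCDTJAMS2001] Thm. A;
[SilvermanAEC2009] C.16 Thm. 16.3; [BurungaleCastellaSkinner2025] §1.2 (disc)/(Heeg); [Marcus1977] Ch. 2 Thm. 1.
-/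

set_option linter.dupNamespace false
set_option autoImplicit false

noncomputable section

open scoped Classical NumberField

open WeierstrassCurve Literature.NumberTheory.EllipticCurves
  Literature.NumberTheory.EllipticCurves.ModularForms
  Summit.BirchSwinnertonDyer.BirchSwinnertonDyer.Rank1Residual
  Summit.BirchSwinnertonDyer.BirchSwinnertonDyer.Theses.TwinTransportX9
  Literature.NumberTheory.QuadraticFields.Quadratic

namespace Summit.BirchSwinnertonDyer.BirchSwinnertonDyer.Theorems.TwinTransportX9Rung

/-! ## §1 The root number flips along every admissible frame -/

/-- **`w(W₁) = -w(W)` along every BCS-admissible frame** (every pair, every frame, every model `W₁` of the twist):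
`d_K` is a negative fundamental discriminant ((disc): square-free, `≡ 1 (mod 4)`), so `K₀ = ℚ(√d_K)` exists and is
imaginary quadratic; (Heeg) is the Heegner hypothesis for `N(W)`; hence `w(W^{(d_K)}) = -w(W)` (Darmon 2004, §3.6:
`sign(E, K) = -1`, from Modularity), and `w` is an isomorphism invariant. BSD is NOT proved.
[cite: Darmon2004, §3.6 Thm. 3.15, Thm. 3.17 and p. 39] [cite: BCDTJAMS2001, Thm. A]
[cite: BurungaleCastellaSkinner2025, §1.2 (disc)/(Heeg)] [cite: Marcus1977, Ch. 2, Thm. 1] -/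
theorem rootNumber_twin_eq_neg (hmod : exists_isNewformOf)
    (W : WeierstrassCurve ℚ) [W.IsElliptic] [W.IsGloballyMinimal] {p : ℕ} {dK dF : ℤ}
    (hadm : BCSAdmissiblePair W p dK dF) (W₁ : WeierstrassCurve ℚ) [W₁.IsElliptic] {C : VariableChange ℚ}
    (hC : C • W₁ = W.quadraticTwist (dK : ℚ)) : W₁.rootNumber = -W.rootNumber := by
  obtain ⟨K₀, _, _, hK₀2, hK₀d⟩ : ∃ (K₀ : Type) (_ : Field K₀) (_ : NumberField K₀),
      Module.finrank ℚ K₀ = 2 ∧ NumberField.discr K₀ = dK :=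
    exists_numberField_discr_eq (Or.inl ⟨hadm.1.2.2.1, hadm.1.2.1, by have := hadm.1.1; omega⟩)
  have hK : IsImaginaryQuadratic K₀ := isImaginaryQuadratic_of_discr_eq_of_neg hK₀2 hK₀d hadm.1.1
  have hH : SatisfiesHeegnerHypothesis (W.conductorNorm ℤ) K₀ := fun ℓ hℓ hℓN =>
    ncard_primesOver_eq_two_of_bcsAdmissiblePair W hadm hK₀2 hK₀d hℓ hℓN
  have h := rootNumber_quadraticTwist_discr_eq_neg_of_exists_isNewformOf W K₀ hmod hK hH
  rw [hK₀d, ← hC] at h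
  rw [← h]
  exact (rootNumber_smul_holds W₁ C).symm

/-! ## §2 The analytic parity flips at each admissible step and returns after two -/

/-- **Parity flip**: along every admissible frame, `r_an(W₁)` is even iff `r_an(W)` is odd
(`w = (-1)^{r_an}` for both curves, from Modularity, and `w(W₁) = -w(W)`). BSD is NOT proved.
[cite: SilvermanAEC2009, C.16 Thm. 16.3 and remark, p. 451] [cite: Darmon2004, §3.9 proof of Thm. 3.22 (p. 40)] -/
theorem even_analyticRank_twin_iff (hmod : exists_isNewformOf)
    (W : WeierstrassCurve ℚ) [W.IsElliptic] [W.IsGloballyMinimal] {p : ℕ} {dK dF : ℤ}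
    (hadm : BCSAdmissiblePair W p dK dF) (W₁ : WeierstrassCurve ℚ) [W₁.IsElliptic] {C : VariableChange ℚ}
    (hC : C • W₁ = W.quadraticTwist (dK : ℚ)) : Even W₁.analyticRank ↔ ¬ Even W.analyticRank := by
  have hneg := rootNumber_twin_eq_neg hmod W hadm W₁ hC
  rw [WeierstrassCurve.rootNumber_eq_neg_one_pow_analyticRank_of_exists_isNewformOf hmod W₁,
    WeierstrassCurve.rootNumber_eq_neg_one_pow_analyticRank_of_exists_isNewformOf hmod W] at hneg
  rw [← neg_one_pow_eq_one_iff_even (R := ℤ) (by norm_num),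
    ← neg_one_pow_eq_one_iff_even (R := ℤ) (by norm_num), hneg]
  rcases neg_one_pow_eq_or ℤ W.analyticRank with h | h <;> rw [h] <;> norm_num

/-- **Two admissible steps restore the parity**: `r_an(W₂) ≡ r_an(W) (mod 2)` along `W ↦ W₁ ↦ W₂` with both frames
admissible. BSD is NOT proved. [cite: Darmon2004, §3.6 Thm. 3.15 and p. 39] -/
theorem even_analyticRank_twin₂_iff (hmod : exists_isNewformOf)
    (W : WeierstrassCurve ℚ) [W.IsElliptic] [W.IsGloballyMinimal] {p : ℕ} {dK dF : ℤ}
    (hadm : BCSAdmissiblePair W p dK dF) (W₁ : WeierstrassCurve ℚ) [W₁.IsElliptic] [W₁.IsGloballyMinimal]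
    {C : VariableChange ℚ} (hC : C • W₁ = W.quadraticTwist (dK : ℚ))
    {dK' dF' : ℤ} (hadm' : BCSAdmissiblePair W₁ p dK' dF') (W₂ : WeierstrassCurve ℚ) [W₂.IsElliptic]
    {C' : VariableChange ℚ} (hC' : C' • W₂ = W₁.quadraticTwist (dK' : ℚ)) :
    Even W₂.analyticRank ↔ Even W.analyticRank := by
  rw [even_analyticRank_twin_iff hmod W₁ hadm' W₂ hC', even_analyticRank_twin_iff hmod W hadm W₁ hC, not_not]

/-! ## §3 Consequences for the two disjuncts of the crux, class-wide -/

/-- **At a pair of EVEN analytic rank the FIRST disjunct is impossible for every admissible frame**: `r_an(W₁)` is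
odd, in particular `≠ 0`. (This is why the rank-`0` X9 pairs need the two-step engine.) BSD is NOT proved.
[cite: Darmon2004, §3.9 proof of Thm. 3.22 (p. 40)] -/
theorem analyticRank_twin_ne_zero_of_even (hmod : exists_isNewformOf)
    (W : WeierstrassCurve ℚ) [W.IsElliptic] [W.IsGloballyMinimal] {p : ℕ} {dK dF : ℤ}
    (hadm : BCSAdmissiblePair W p dK dF) (W₁ : WeierstrassCurve ℚ) [W₁.IsElliptic] {C : VariableChange ℚ}
    (hC : C • W₁ = W.quadraticTwist (dK : ℚ)) (h0 : Even W.analyticRank) : W₁.analyticRank ≠ 0 := by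
  intro h
  have h1 : Even W₁.analyticRank := by rw [h]; exact Even.zero
  exact (even_analyticRank_twin_iff hmod W hadm W₁ hC).mp h1 h0

/-- **At a pair of ODD analytic rank every one-step admissible twin has EVEN analytic rank** (so `r_an(W₁) = 0`
unless `r_an(W₁) ≥ 2`). BSD is NOT proved. [cite: Darmon2004, §3.9 proof of Thm. 3.22 (p. 40)] -/
theorem even_analyticRank_twin_of_odd (hmod : exists_isNewformOf)
    (W : WeierstrassCurve ℚ) [W.IsElliptic] [W.IsGloballyMinimal] {p : ℕ} {dK dF : ℤ}
    (hadm : BCSAdmissiblePair W p dK dF) (W₁ : WeierstrassCurve ℚ) [W₁.IsElliptic] {C : VariableChange ℚ}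
    (hC : C • W₁ = W.quadraticTwist (dK : ℚ)) (h1 : Odd W.analyticRank) : Even W₁.analyticRank :=
  (even_analyticRank_twin_iff hmod W hadm W₁ hC).mpr (Nat.not_even_iff_odd.mpr h1)

/-- **At a pair of ODD analytic rank the SECOND disjunct is impossible for every pair of admissible frames**:
`r_an(W₂)` is odd, in particular `≠ 0`. BSD is NOT proved. [cite: Darmon2004, §3.9 proof of Thm. 3.22 (p. 40)] -/
theorem analyticRank_twin₂_ne_zero_of_odd (hmod : exists_isNewformOf)
    (W : WeierstrassCurve ℚ) [W.IsElliptic] [W.IsGloballyMinimal] {p : ℕ} {dK dF : ℤ}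
    (hadm : BCSAdmissiblePair W p dK dF) (W₁ : WeierstrassCurve ℚ) [W₁.IsElliptic] [W₁.IsGloballyMinimal]
    {C : VariableChange ℚ} (hC : C • W₁ = W.quadraticTwist (dK : ℚ))
    {dK' dF' : ℤ} (hadm' : BCSAdmissiblePair W₁ p dK' dF') (W₂ : WeierstrassCurve ℚ) [W₂.IsElliptic]
    {C' : VariableChange ℚ} (hC' : C' • W₂ = W₁.quadraticTwist (dK' : ℚ)) (h1 : Odd W.analyticRank) :
    W₂.analyticRank ≠ 0 := by
  intro h
  have h2 : Even W₂.analyticRank := by rw [h]; exact Even.zero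
  exact Nat.not_even_iff_odd.mpr h1 ((even_analyticRank_twin₂_iff hmod W hadm W₁ hC hadm' W₂ hC').mp h2)

/-! ## §4 The crux splits by analytic parity -/

/-- **PARITY CASES OF THE CRUX (class-wide).** Under Modularity, `TrivialTwinSupplyX9` gives, at every X9 pair with
`p ∤ ∏ c_ℓ(W)`: if `r_an(W)` is ODD, a ONE-step admissible unit twin (first disjunct); if `r_an(W)` is EVEN, a
TWO-step admissible unit twin (second disjunct) — the other disjunct being impossible in each case (§3).
BSD is NOT proved; the crux is the hypothesis `h`. [cite: Darmon2004, §3.9 proof of Thm. 3.22 (p. 40)]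
[cite: BurungaleCastellaSkinner2025, §1.2, Prop. 5.2.1] -/
theorem trivialTwinSupplyX9_parityCases (hmod : exists_isNewformOf) (h : TrivialTwinSupplyX9)
    (W : WeierstrassCurve ℚ) [W.IsElliptic] [W.IsGloballyMinimal] (p : ℕ) [Fact p.Prime]
    (hX9 : ClassX9 W p) (hTam : ¬ p ∣ W.tamagawaProduct) :
    (Odd W.analyticRank → ∃ dK dF : ℤ, BCSAdmissiblePair W p dK dF ∧
      ∃ (W₁ : WeierstrassCurve ℚ) (_ : W₁.IsElliptic) (_ : W₁.IsGloballyMinimal),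
        (∃ C : WeierstrassCurve.VariableChange ℚ, C • W₁ = W.quadraticTwist (dK : ℚ)) ∧
        W₁.analyticRank = 0 ∧ ¬ p ∣ W₁.shaOrder ∧ ¬ p ∣ W₁.tamagawaProduct ∧ ¬ p ∣ W₁.torsionOrder ∧
        ∃ q : ℚ, W₁.leadingLCoeff / (W₁.realPeriodRat : ℂ) = (q : ℂ) ∧ padicValRat p q = 0) ∧
    (Even W.analyticRank → ∃ dK dF : ℤ, BCSAdmissiblePair W p dK dF ∧
      ∃ (W₁ : WeierstrassCurve ℚ) (_ : W₁.IsElliptic) (_ : W₁.IsGloballyMinimal),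
        (∃ C : WeierstrassCurve.VariableChange ℚ, C • W₁ = W.quadraticTwist (dK : ℚ)) ∧
        ∃ dK' dF' : ℤ, BCSAdmissiblePair W₁ p dK' dF' ∧
          ∃ (W₂ : WeierstrassCurve ℚ) (_ : W₂.IsElliptic) (_ : W₂.IsGloballyMinimal),
            (∃ C : WeierstrassCurve.VariableChange ℚ, C • W₂ = W₁.quadraticTwist (dK' : ℚ)) ∧
            W₂.analyticRank = 0 ∧ ¬ p ∣ W₂.shaOrder ∧ ¬ p ∣ W₂.tamagawaProduct ∧ ¬ p ∣ W₂.torsionOrder ∧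
            ∃ q : ℚ, W₂.leadingLCoeff / (W₂.realPeriodRat : ℂ) = (q : ℂ) ∧ padicValRat p q = 0) := by
  obtain ⟨dK, dF, hadm, W₁, i₁, i₁', ⟨C, hC⟩, hcase⟩ := h W p hX9 hTam
  haveI := i₁; haveI := i₁'
  constructor
  · intro hodd
    rcases hcase with ⟨hr, hsha, hT, htor, hq⟩ | ⟨dK', dF', hadm', W₂, i₂, i₂', ⟨C', hC'⟩, hr, -, -, -, -⟩
    · exact ⟨dK, dF, hadm, W₁, i₁, i₁', ⟨C, hC⟩, hr, hsha, hT, htor, hq⟩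
    · haveI := i₂
      exact absurd hr (analyticRank_twin₂_ne_zero_of_odd hmod W hadm W₁ hC hadm' W₂ hC' hodd)
  · intro heven
    rcases hcase with ⟨hr, -, -, -, -⟩ | ⟨dK', dF', hadm', W₂, i₂, i₂', hC', hr, hsha, hT, htor, hq⟩
    · exact absurd hr (analyticRank_twin_ne_zero_of_even hmod W hadm W₁ hC heven)
    · exact ⟨dK, dF, hadm, W₁, i₁, i₁', ⟨C, hC⟩, dK', dF', hadm', W₂, i₂, i₂', hC', hr, hsha, hT, htor, hq⟩

/-- **Conversely the two parity cases assemble the crux** (no Modularity needed: `r_an(W)` is even or odd).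
So, under Modularity, `TrivialTwinSupplyX9` is EQUIVALENT to the conjunction of its ODD-pair one-step form and its
EVEN-pair two-step form — two independent sub-statements, each about half of the X9 pairs. BSD is NOT proved;
neither case is proved. [cite: BurungaleCastellaSkinner2025, §1.2, Prop. 5.2.1] [cite: Prasanna2010CJM, p. 400] -/
theorem trivialTwinSupplyX9_of_parityCases
    (hodd : ∀ (W : WeierstrassCurve ℚ) [W.IsElliptic] [W.IsGloballyMinimal] (p : ℕ) [Fact p.Prime],
      ClassX9 W p → ¬ p ∣ W.tamagawaProduct → Odd W.analyticRank →
      ∃ dK dF : ℤ, BCSAdmissiblePair W p dK dF ∧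
        ∃ (W₁ : WeierstrassCurve ℚ) (_ : W₁.IsElliptic) (_ : W₁.IsGloballyMinimal),
          (∃ C : WeierstrassCurve.VariableChange ℚ, C • W₁ = W.quadraticTwist (dK : ℚ)) ∧
          W₁.analyticRank = 0 ∧ ¬ p ∣ W₁.shaOrder ∧ ¬ p ∣ W₁.tamagawaProduct ∧ ¬ p ∣ W₁.torsionOrder ∧
          ∃ q : ℚ, W₁.leadingLCoeff / (W₁.realPeriodRat : ℂ) = (q : ℂ) ∧ padicValRat p q = 0)
    (heven : ∀ (W : WeierstrassCurve ℚ) [W.IsElliptic] [W.IsGloballyMinimal] (p : ℕ) [Fact p.Prime],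
      ClassX9 W p → ¬ p ∣ W.tamagawaProduct → Even W.analyticRank →
      ∃ dK dF : ℤ, BCSAdmissiblePair W p dK dF ∧
        ∃ (W₁ : WeierstrassCurve ℚ) (_ : W₁.IsElliptic) (_ : W₁.IsGloballyMinimal),
          (∃ C : WeierstrassCurve.VariableChange ℚ, C • W₁ = W.quadraticTwist (dK : ℚ)) ∧
          ∃ dK' dF' : ℤ, BCSAdmissiblePair W₁ p dK' dF' ∧
            ∃ (W₂ : WeierstrassCurve ℚ) (_ : W₂.IsElliptic) (_ : W₂.IsGloballyMinimal),
              (∃ C : WeierstrassCurve.VariableChange ℚ, C • W₂ = W₁.quadraticTwist (dK' : ℚ)) ∧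
              W₂.analyticRank = 0 ∧ ¬ p ∣ W₂.shaOrder ∧ ¬ p ∣ W₂.tamagawaProduct ∧ ¬ p ∣ W₂.torsionOrder ∧
              ∃ q : ℚ, W₂.leadingLCoeff / (W₂.realPeriodRat : ℂ) = (q : ℂ) ∧ padicValRat p q = 0) :
    TrivialTwinSupplyX9 := by
  intro W _ _ p _ hX9 hTam
  rcases Nat.even_or_odd W.analyticRank with he | ho
  · obtain ⟨dK, dF, hadm, W₁, i₁, i₁', hC, dK', dF', hadm', W₂, i₂, i₂', hC', hr, hsha, hT, htor, hq⟩ :=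
      heven W p hX9 hTam he
    exact ⟨dK, dF, hadm, W₁, i₁, i₁', hC, Or.inr ⟨dK', dF', hadm', W₂, i₂, i₂', hC', hr, hsha, hT, htor, hq⟩⟩
  · obtain ⟨dK, dF, hadm, W₁, i₁, i₁', hC, hr, hsha, hT, htor, hq⟩ := hodd W p hX9 hTam ho
    exact ⟨dK, dF, hadm, W₁, i₁, i₁', hC, Or.inl ⟨hr, hsha, hT, htor, hq⟩⟩

end Summit.BirchSwinnertonDyer.BirchSwinnertonDyer.Theorems.TwinTransportX9Rung
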